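import Summits.Schanuel.Schanuel.Theorems.DiophantineDichotomyDefs
import Summits.Schanuel.Schanuel.Theorems.DiophantineDichotomyKhovanskiiApproxTypeSlotDichotomyTwo
import Summits.Schanuel.Schanuel.Theorems.DiophantineDichotomyKhovanskiiApproxTypeLWLayer

/-!
# Line `height-window-compactness` — crux `DiophantineDichotomy.KhovanskiiApproxType` (stmt-Schanuel-6116)
# Skeleton v1 (planner `planner-cruxplan-stmt-Schanuel-6116-height-window-compac-0`, 2026-08-16)

Crux (route `DiophantineDichotomy`, FIXED): for `n ≥ 2` and every free Khovanskii point
`θ = (s, e^s) ∈ ℂ²ⁿ` with `ℚ`-linearly independent `s`, `∃ a < 1/(n−1), b, C > 0` with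
`‖γ − θ‖ ≥ exp(−C(dᵃ log H + dᵇ))` for every algebraic challenger `γ` (field degree `≤ d`, every
coordinate a root of a non-zero integer polynomial of degree `≤ d` and height `≤ H`).

**The line (idea card `Ideas/height-window-compactness.md`, triage r1-2 / r1-3: pass).**  Cut the
Lindemann–Weierstrass layer (`n = 2`, `s ∈ ℚ̄²`) of the TYPED crux by HEIGHT WINDOWS at each degree:

* ABOVE the double-exponential threshold `H ≥ T_κ(d) = exp(exp(κ d log(d+2)))` the typed bound is
  PRINTED: Ably 1994 (Acta Arith. 67, Théorème p. 30: for `y ∈ ℚ̄ᵐ` lin. independent and every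
  non-zero `P ∈ ℤ[X₁..X_m]`, `deg ≤ D`, height `≤ H`: `log|P(e^{y})| ≥ −c₂Dᵐ(log H + exp(CDᵐlog(D+1)))`,
  ALL heights) is a codimension-one measure with the Dirichlet-optimal degree exponent and a
  height-free PENALTY of class `exp(κ Dᵐ log(D+2))` — stub `stub_lwPenaltyMeasure` — and the LANDED
  spine of line `lw-small-height` (relative Siegel lemma `stub_siegelInIdeal` p76390 — reused as is,
  it is penalty-free; transfer p76504; slot dichotomy p75181) RE-RUN with that penalty class in place
  of the polynomial `(deg)^K` — stubs `stub_penaltyTransfer`, `stub_penaltySlotDichotomy_two`, both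
  provable now by adapting the landed proofs — gives at every LW point the PENALTY FORM of the crux
  `ApproxTypePenAt 2 s (3/4) κ C : ‖γ − θ‖ ≥ exp(−(C d^{3/4} log H + exp(κ d log(d+2))))`, which
  above `T_κ(d)` is the typed bound with `C + 1` (`typed_above_of_pen`, PROVED here).
* BELOW `exp(d^{b₀})` the typed bound is a pure power of `d` and follows from ONE slot with a
  transcendence measure polynomial in the size `deg + log height`: stub `stub_expFiniteType` (Lang's
  finite type of transcendence of `e^β`, `β ∈ ℚ̄*`; printed `≤ 3 + ε`: Chudnovsky 1984 Introduction
  p. 26, after Cijsouw 1972 / Waldschmidt 1978) through an irreducible factor of the annihilating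
  polynomial, Mahler's coefficient bound and the mean value theorem (`approxFloor_of_finiteType`,
  PROVED here with the landed `abs_coeff_le_of_dvd` / `norm_aeval_sub_aeval_le`).
* The WINDOW `exp(d^{b₀}) ≤ H < T_κ(d)` is the ONLY open piece of the typed crux at LW points:
  stub `stub_lwWindow_two` (= the picked line's `LWSmallHeight 1 ∧ 2` restricted to that window;
  `lwWindowTwo_of_lwSmallHeight`, PROVED here from the landed `approxTypeAt_two_of_LW`, shows the
  picked line's research stubs still close it).
* Off the LW layer nothing changes: `stub_nonLWInputs_two : NonLWInputsTwo` (Schanuel-strength at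
  the non-LW `n = 2` points, fed to the landed `approxTypeAt_two_of_inputs`) and
  `stub_rankThreeUp : RankThreeUp` (= the crux for `n ≥ 3`, residual) are RE-REGISTERED VERBATIM
  (same names and signatures as in `Lines/lw-small-height.lean`, so their registrations and any
  `--supports` proofs stay valid).

Composition (sorry-free): `approxTypePenAt_two_of_LW` (ABOVE in penalty form), `typed_above_of_pen`,
`approxFloor_of_finiteType` (floor), `approxTypeAt_of_pen_window_floor` (the three height regimes ⇒
the typed pointwise crux, monotonicity in `(a, b, C)`), `approxTypeAt_two_of_LW_windows` (LW layer),
`khovanskiiApproxType_of_stubs` (the seven stub STATEMENTS ⇒ the crux, pointwise form),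
`KhovanskiiApproxType_of` (concludes the crux BY NAME from the registered stubs).
`slotFloor_false_of_lt_one` does not concern stub 4: Lang's type `τ` is in the size currency
(`τ ≥ 2` by Dirichlet) and any finite `τ` is enough below `exp(d^{b₀})`.

Route-level signal (NOT a stub; IdeatorK2Notes.md §A, verified by triage r1-2 and r1-3): the
exponent race `ApproximationRace` can be run at FIXED `Δ` with `Y → ∞`, so the route consumes only
the EVENTUAL-in-`H` measure; `ApproxTypePenAt` ⇒ eventual with threshold `T_κ(d)`, hence under the
tenure restatement `KhovanskiiApproxTypeEv` the LW layer of the crux-as-used is exactly stubs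
1–3 of this skeleton (no window, no floor).

Disproof used (`Cruxes/KhovanskiiApproxType/Disproof.lean`, cdisprove cycle 1 FINAL, no kill):
`khovanskiiApproxType_false_without_linIndep` / `_false_from_one` / `not_approxTypeAt_const_one`
(Diaz beats every `a < 1` along ONE transcendental slot) — honoured: the LW layer charges BOTH slots
`e^{s₁}, e^{s₂}` (`stub_penaltySlotDichotomy_two`, `a = A p/(A+1) = 3/4 ≥ 1/2` = route-review floor
`1/n`), linear independence enters at `stub_lwPenaltyMeasure` (Lindemann–Weierstrass) and at the
one-slot floors (`s i ≠ 0`); `not_khovanskiiApproxTypeUniform` (constants not uniform in the point)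
— respected: every `∃ κ C …` here comes after `s`; `khovanskiiApproxType_false_without_khovanskii`
(ultra-Liouville limits of degenerate tuples) — not an instance: LW points are honest free Khovanskii
points (`gᵢ = minpoly(sᵢ)`); `slotFloor_false_of_lt_one` (`A ≥ 1`) — consistent: floors are used
with `A = 1` (Ably, `m = 1`), never `A < 1`; stub 4 is Lang's type in the size currency (`τ ≥ 2`).
-/

noncomputable section

set_option linter.dupNamespace false

open scoped BigOperators

namespace Summit.Schanuel.Schanuel.Cruxes.KhovanskiiApproxType.HeightWindowCompactness

open Summit.Schanuel.Schanuel.Theses.DiophantineDichotomy (KhovanskiiApproxType)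
open Summit.Schanuel.Schanuel.Cruxes.KhovanskiiApproxType.LwSmallHeight
open Polynomial

/-! ## Vocabulary: the Ably penalty class — now IMPORTED

buildfix 2026-08-19: the ten objects of this line (`CodimOneMeasureX`, `SlotFloorX`,
`PrimitiveApproxMeasureX`, `ApproxTypePenAt`, `LWPenaltyMeasure`, `CodimOneTransferX`,
`SlotDichotomyXTwo`, `HasTranscendenceType`, `ExpFiniteType`, `LWWindowTwo`) were landed VERBATIM, in this
same namespace, in `Theorems/DiophantineDichotomyDefs.lean` (imported above) so that the stub files could
share them; their local copies are deleted here (they no longer elaborate: `has already been declared`).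
Statements of every stub below are unchanged and now refer to the imported definitions. -/

/-! STUB 6, 7 statements: `NonLWInputsTwo`, `RankThreeUp` — imported from `DiophantineDichotomyDefs`
(the picked line's open stubs, unchanged). -/

/-! ## Registered stubs -/

/-- STUB 1 (printed, Ably 1994 Théorème p. 30; size XL to formalise, vendorable as a named fact):
the all-heights Lindemann–Weierstrass measure with Dirichlet-optimal degree exponent and Ably-class
penalty, every `m ≥ 1`. -/
theorem stub_lwPenaltyMeasure : LWPenaltyMeasure := by
  sorry

/-- STUB 2 (provable now, size M: re-run of the landed transfer p76504 with the penalty class; the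
relative Siegel lemma `stub_siegelInIdeal` p76390 is penalty-free and reused). -/
theorem stub_penaltyTransfer : CodimOneTransferX := by
  sorry

/-- STUB 3 (provable now, size M: re-run of the landed slot dichotomy p75181 with the penalty class). -/
theorem stub_penaltySlotDichotomy_two : SlotDichotomyXTwo := by
  sorry

/-- STUB 4 (printed: Lang's finite type of transcendence of `e^β`, `β ∈ ℚ̄*` — `≤ 3 + ε`,
Chudnovsky 1984 p. 26; size XL to formalise, vendorable as a named fact). -/
theorem stub_expFiniteType : ExpFiniteType := by
  sorry

/-- STUB 5 (OPEN, size XL — the hardest own stub of the line: the typed bound in the height window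
`exp(d^{b₀}) ≤ H < exp(exp(κ d log(d+2)))` at Lindemann–Weierstrass points). -/
theorem stub_lwWindow_two : LWWindowTwo := by
  sorry

/-- STUB 6 (OPEN, Schanuel-strength pointwise; re-registered verbatim from line `lw-small-height`):
`C⁺ (μ)` + floors `(A)` with `A(μ+1) < 2(A+1)` at every non-LW `n = 2` free Khovanskii point. -/
theorem stub_nonLWInputs_two : NonLWInputsTwo := by
  sorry

/-- STUB 7 (residual = the crux for `n ≥ 3`; re-registered verbatim from line `lw-small-height`). -/
theorem stub_rankThreeUp : RankThreeUp := by
  sorry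

/-! ## Composition (sorry-free) -/

/-! ### Bookkeeping lemmas -/

/-- The challenger clauses force `d ≥ 1` and `H ≥ 1`. -/
theorem one_le_of_clause {α : ℂ} {d H : ℕ}
    (h : ∃ P : Polynomial ℤ, P ≠ 0 ∧ P.natDegree ≤ d ∧ (∀ k, |P.coeff k| ≤ (H : ℤ)) ∧
      Polynomial.aeval α P = 0) : (1 : ℝ) ≤ d ∧ (1 : ℝ) ≤ H := by
  obtain ⟨P, hP0, hPdeg, hPH, hPα⟩ := h
  have hd1 : 1 ≤ d := (natDegree_pos_of_aeval_eq_zero hP0 hPα).1.trans_le hPdeg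
  have hH1 : (1 : ℤ) ≤ H :=
    (Int.one_le_abs (leadingCoeff_ne_zero.2 hP0)).trans (hPH P.natDegree)
  exact ⟨by exact_mod_cast hd1, by exact_mod_cast hH1⟩

/-- Monotonicity of the typed exponent `C(dᵃ L + dᵇ)` in `(a, b, C)` for `d ≥ 1`, `L ≥ 0`. -/
theorem typedExponent_mono {d L a a' b b' C C' : ℝ} (hd : 1 ≤ d) (hL : 0 ≤ L) (hC : 0 ≤ C)
    (hCC' : C ≤ C') (ha : a ≤ a') (hb : b ≤ b') :
    C * (d ^ a * L + d ^ b) ≤ C' * (d ^ a' * L + d ^ b') := by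
  have hd0 : 0 ≤ d := zero_le_one.trans hd
  have h1 : d ^ a ≤ d ^ a' := Real.rpow_le_rpow_of_exponent_le hd ha
  have h2 : d ^ b ≤ d ^ b' := Real.rpow_le_rpow_of_exponent_le hd hb
  have h3 : 0 ≤ d ^ a' * L + d ^ b' :=
    add_nonneg (mul_nonneg (Real.rpow_nonneg hd0 _) hL) (Real.rpow_nonneg hd0 _)
  have h4 : d ^ a * L + d ^ b ≤ d ^ a' * L + d ^ b' :=
    add_le_add (mul_le_mul_of_nonneg_right h1 hL) h2
  calc C * (d ^ a * L + d ^ b) ≤ C * (d ^ a' * L + d ^ b') := mul_le_mul_of_nonneg_left h4 hC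
    _ ≤ C' * (d ^ a' * L + d ^ b') := mul_le_mul_of_nonneg_right hCC' h3

/-! ### ABOVE: the penalty form at Lindemann–Weierstrass points, and the typed bound above `T_κ(d)` -/

/-- **ABOVE, penalty form** (stubs 1–3): at `s ∈ ℚ̄²` with `ℚ`-linearly independent coordinates,
`LWPenaltyMeasure` at `m = 2` is `C⁺` with `μ = 2` at `(e^{s₁}, e^{s₂})` in the Ably class, at
`m = 1` it gives the floors with `A = 1` at each `e^{sᵢ}`, the penalty transfer gives `p = 3/2`, and
the penalty slot dichotomy (`1 · 3/2 < 2`) gives the penalty form of the crux with some `a < 1`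
(the bookkeeping gives `a = 3/4`). -/
theorem approxTypePenAt_two_of_LW (h₁ : LWPenaltyMeasure) (hT : CodimOneTransferX)
    (hD : SlotDichotomyXTwo) (s : Fin 2 → ℂ) (halg : ∀ i, IsAlgebraic ℚ (s i))
    (hli : LinearIndependent ℚ s) : ∃ a κ C : ℝ, a < 1 ∧ ApproxTypePenAt 2 s a κ C := by
  -- `C⁺` on the LW layer: Ably's measure at `(e^{s₁}, e^{s₂})`
  obtain ⟨κ, C, hC⟩ := h₁ 2 s (by norm_num) halg hli
  -- the transfer in the penalty class: primitive approximation measure with `p = (2+1)/2`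
  obtain ⟨κ', C', hP⟩ := hT 2 (Complex.exp ∘ s) ((2 : ℕ) : ℝ) κ C (by norm_num) (by positivity) hC
  -- the floors at the two `y`-slots: Ably's measure at `m = 1` at `e^{s i}`
  have hfloors : ∀ i : Fin 2, ∃ κ₁ C₁ : ℝ,
      SlotFloorX (Sum.elim s (Complex.exp ∘ s) (Sum.inr i)) ((1 : ℕ) : ℝ) κ₁ C₁ := by
    intro i
    have hli1 : LinearIndependent ℚ (fun _ : Fin 1 => s i) :=
      linearIndependent_unique_iff.2 (hli.ne_zero i)
    obtain ⟨κ₁, C₁, h⟩ := h₁ 1 (fun _ => s i) le_rfl (fun _ => halg i) hli1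
    exact ⟨κ₁, C₁, h⟩
  -- the slot dichotomy with `A = 1`, `p = 3/2`: `A p = 3/2 < 2 = A + 1`
  exact hD s Sum.inr _ _ C' ((1 : ℕ) : ℝ) Sum.inr_injective (by positivity) (by norm_num)
    (by norm_num) hP hfloors

/-- **The typed bound ABOVE the Ably threshold** `H ≥ exp(exp(κ d log(d+2)))` from the penalty form:
there `exp(κ d log(d+2)) ≤ log H ≤ d^{a⁺} log H`, so the penalty is absorbed by `C ↦ C + 1`
(`a⁺ = max a 0`; any `b`). -/
theorem typed_above_of_pen {s : Fin 2 → ℂ} {a κ C : ℝ} (h : ApproxTypePenAt 2 s a κ C) (b : ℝ)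
    (d H : ℕ) (γ : Fin 2 ⊕ Fin 2 → ℂ)
    (hH : Real.exp (Real.exp (κ * d * Real.log ((d : ℝ) + 2))) ≤ (H : ℝ))
    (hfr : Module.finrank ℚ ↥(IntermediateField.adjoin ℚ (Set.range γ)) ≤ d)
    (hpoly : ∀ i, ∃ P : Polynomial ℤ, P ≠ 0 ∧ P.natDegree ≤ d ∧ (∀ k, |P.coeff k| ≤ (H : ℤ)) ∧
      Polynomial.aeval (γ i) P = 0) :
    Real.exp (-((C + 1) * ((d : ℝ) ^ (max a 0) * Real.log H + (d : ℝ) ^ b))) ≤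
      ‖γ - Sum.elim s (Complex.exp ∘ s)‖ := by
  obtain ⟨hC, hall⟩ := h
  obtain ⟨hd1, hH1⟩ := one_le_of_clause (hpoly (Sum.inl 0))
  have hd0 : (0 : ℝ) ≤ d := zero_le_one.trans hd1
  have hHpos : (0 : ℝ) < H := one_pos.trans_le hH1
  have hlogH : 0 ≤ Real.log H := Real.log_nonneg hH1
  set E : ℝ := Real.exp (κ * d * Real.log ((d : ℝ) + 2)) with hE
  have hEL : E ≤ Real.log H := (Real.le_log_iff_exp_le hHpos).2 hH
  have hda : (d : ℝ) ^ a ≤ (d : ℝ) ^ (max a 0) := Real.rpow_le_rpow_of_exponent_le hd1 (le_max_left _ _)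
  have hda1 : 1 ≤ (d : ℝ) ^ (max a 0) := Real.one_le_rpow hd1 (le_max_right _ _)
  have hdb : 0 ≤ (d : ℝ) ^ b := Real.rpow_nonneg hd0 _
  have key : C * (d : ℝ) ^ a * Real.log H + E ≤
      (C + 1) * ((d : ℝ) ^ (max a 0) * Real.log H + (d : ℝ) ^ b) := by
    have h1 : C * (d : ℝ) ^ a * Real.log H ≤ C * (d : ℝ) ^ (max a 0) * Real.log H := by
      have := mul_le_mul_of_nonneg_right hda hlogH
      nlinarith [this, hC]
    have h2 : E ≤ (d : ℝ) ^ (max a 0) * Real.log H :=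
      hEL.trans (le_mul_of_one_le_left hlogH hda1)
    nlinarith [h1, h2, hdb, hC, mul_nonneg (zero_le_one.trans hda1) hlogH]
  exact le_trans (Real.exp_le_exp.2 (neg_le_neg key)) (hall d H γ hfr hpoly)

/-! ### BELOW: one slot of finite transcendence type gives a pure-power floor at small heights -/

/-- **FLOOR below `exp(d^{b₀})` from finite type at the slot `e^{s₀}`**: an irreducible factor `f` of
the challenger's annihilating polynomial at that slot vanishes at `γ(e^{s₀}-slot)`, has `deg f ≤ d`
and coefficients `≤ 2^d(d+1)H` (Mahler/Mignotte, landed `abs_coeff_le_of_dvd`), so Lang's type bound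
gives `|f(e^{s₀})| ≥ exp(−C(d + 2d + log H)^τ)` while the mean value theorem (landed
`norm_aeval_sub_aeval_le`) gives `|f(e^{s₀})| ≤ exp((4 + log R)d + log H)·|γ − θ|`; for
`log H < d^{b₀}` everything is `≤ C' d^B`, `B = max(b₀,1)(τ⁺ + 1)`. -/
theorem approxFloor_of_finiteType (s : Fin 2 → ℂ) {τ C : ℝ}
    (hft : HasTranscendenceType (Complex.exp (s 0)) τ C) (b₀ : ℝ) :
    ∃ B C' : ℝ, 0 < C' ∧ ∀ (d H : ℕ) (γ : Fin 2 ⊕ Fin 2 → ℂ),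
      (H : ℝ) < Real.exp ((d : ℝ) ^ b₀) →
      Module.finrank ℚ ↥(IntermediateField.adjoin ℚ (Set.range γ)) ≤ d →
      (∀ i, ∃ P : Polynomial ℤ, P ≠ 0 ∧ P.natDegree ≤ d ∧ (∀ k, |P.coeff k| ≤ (H : ℤ)) ∧
        Polynomial.aeval (γ i) P = 0) →
      Real.exp (-(C' * (d : ℝ) ^ B)) ≤ ‖γ - Sum.elim s (Complex.exp ∘ s)‖ := by
  set θ : Fin 2 ⊕ Fin 2 → ℂ := Sum.elim s (Complex.exp ∘ s) with hθ
  set τp : ℝ := max τ 0 with hτp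
  set B₀ : ℝ := max b₀ 1 with hB₀
  set B : ℝ := B₀ * τp + B₀ with hB
  set R : ℝ := ‖θ‖ + 2 with hR
  set C' : ℝ := C * (4 : ℝ) ^ τp + 5 + Real.log R with hC'
  have hC : 0 < C := hft.1
  have hR1 : 1 ≤ R := by have := norm_nonneg θ; rw [hR]; linarith
  have hlogR : 0 ≤ Real.log R := Real.log_nonneg hR1
  have hτp0 : 0 ≤ τp := le_max_right _ _
  have hB₀1 : 1 ≤ B₀ := le_max_right _ _
  have h4p : 0 ≤ (4 : ℝ) ^ τp := Real.rpow_nonneg (by norm_num) _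
  have hC'pos : 0 < C' := by
    have : 0 ≤ C * (4 : ℝ) ^ τp := mul_nonneg hC.le h4p
    rw [hC']; linarith
  refine ⟨B, C', hC'pos, ?_⟩
  intro d H γ hHlt _hfr hpoly
  obtain ⟨P, hP0, hPdeg, hPH, hPγ⟩ := hpoly (Sum.inr 0)
  obtain ⟨hd1r, hH1r⟩ := one_le_of_clause (hpoly (Sum.inr 0))
  have hd1 : 1 ≤ d := by exact_mod_cast hd1r
  have hd0 : (0 : ℝ) < d := one_pos.trans_le hd1r
  have hH0 : (0 : ℝ) < H := one_pos.trans_le hH1r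
  have hlogH : 0 ≤ Real.log H := Real.log_nonneg hH1r
  have hdB0 : 0 ≤ (d : ℝ) ^ B := Real.rpow_nonneg hd0.le _
  have hX0 : 0 ≤ C' * (d : ℝ) ^ B := mul_nonneg hC'pos.le hdB0
  by_cases hfar : 1 < ‖γ - θ‖
  · exact le_trans (by rw [Real.exp_le_one_iff]; linarith) hfar.le
  push Not at hfar
  have hcoord : ‖γ (Sum.inr 0) - θ (Sum.inr 0)‖ ≤ ‖γ - θ‖ := by
    simpa using norm_le_pi_norm (γ - θ) (Sum.inr 0)
  have hθj : ‖θ (Sum.inr 0)‖ ≤ ‖θ‖ := norm_le_pi_norm θ (Sum.inr 0)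
  have hξR : ‖θ (Sum.inr 0)‖ ≤ R := by rw [hR]; linarith
  have hαR : ‖γ (Sum.inr 0)‖ ≤ R := by
    linarith [hcoord, hθj, norm_sub_norm_le (γ (Sum.inr 0)) (θ (Sum.inr 0))]
  -- an irreducible factor of `P` vanishing at the slot, its degree and coefficients
  obtain ⟨f, hfirr, hfP, hfα⟩ := exists_irreducible_factor_aeval_eq_zero (γ (Sum.inr 0)) P hP0 hPγ
  have hf0 : f ≠ 0 := hfirr.ne_zero
  have hfd : f.natDegree ≤ d := (natDegree_le_of_dvd hfP hP0).trans hPdeg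
  set Bh : ℝ := 2 ^ d * ((d : ℝ) + 1) * H with hBh
  have hcoeff : ∀ k, |(f.coeff k : ℝ)| ≤ Bh := abs_coeff_le_of_dvd hfP hP0 hPdeg hPH
  have j1 : (d : ℝ) + 1 ≤ Real.exp d := Real.add_one_le_exp d
  have j2 : (2 : ℝ) ^ d ≤ Real.exp d := by
    calc (2 : ℝ) ^ d ≤ (Real.exp 1) ^ d :=
          pow_le_pow_left₀ (by norm_num) (by linarith [Real.add_one_le_exp (1 : ℝ)]) d
      _ = Real.exp d := by rw [← Real.exp_nat_mul, mul_one]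
  have hBh1 : 1 ≤ Bh :=
    one_le_mul_of_one_le_of_one_le (one_le_mul_of_one_le_of_one_le (one_le_pow₀ (by norm_num))
      (by linarith)) hH1r
  have hBh0 : 0 < Bh := one_pos.trans_le hBh1
  have hlogBh : Real.log Bh ≤ 2 * d + Real.log H := by
    have h : Bh ≤ Real.exp d * Real.exp d * H := by rw [hBh]; gcongr
    have h' := Real.log_le_log hBh0 h
    rw [Real.log_mul (mul_pos (Real.exp_pos _) (Real.exp_pos _)).ne' hH0.ne',
      Real.log_mul (Real.exp_pos _).ne' (Real.exp_pos _).ne', Real.log_exp] at h'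
    linarith
  -- Lang's type bound at `f`, degree `≤ d`, coefficients `≤ Bh`
  have hlow : Real.exp (-(C * ((d : ℝ) + Real.log Bh) ^ τ)) ≤ ‖aeval (θ (Sum.inr 0)) f‖ :=
    hft.2 f d Bh hf0 hd1 hfd hBh1 hcoeff
  -- the mean value bound
  have hmv : ‖aeval (θ (Sum.inr 0)) f‖ ≤
      ((d : ℝ) + 1) * (Bh * (d * R ^ d)) * ‖θ (Sum.inr 0) - γ (Sum.inr 0)‖ := by
    simpa only [hfα, sub_zero] using norm_aeval_sub_aeval_le f hR1 hξR hαR hcoeff hfd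
  have hD : ((d : ℝ) + 1) * (Bh * (d * R ^ d)) ≤ Real.exp ((4 + Real.log R) * d + Real.log H) := by
    have e1 : Real.exp d * Real.exp d * Real.exp d * Real.exp d * R ^ d * H =
        Real.exp ((4 + Real.log R) * d + Real.log H) := by
      rw [show (4 + Real.log R) * d + Real.log H =
          (d : ℝ) + d + d + d + Real.log R * d + Real.log H by ring]
      simp only [Real.exp_add]
      rw [Real.exp_log hH0, ← Real.rpow_def_of_pos (one_pos.trans_le hR1), Real.rpow_natCast]
    have j3 : (d : ℝ) ≤ Real.exp d := by linarith
    rw [← e1, hBh]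
    calc ((d : ℝ) + 1) * (2 ^ d * ((d : ℝ) + 1) * H * (d * R ^ d))
        = ((d : ℝ) + 1) * 2 ^ d * ((d : ℝ) + 1) * d * R ^ d * H := by ring
      _ ≤ Real.exp d * Real.exp d * Real.exp d * Real.exp d * R ^ d * H := by gcongr
  -- exponent bookkeeping below `exp(d^{b₀})`: everything is `≤ C' d^B`
  have key : C * ((d : ℝ) + Real.log Bh) ^ τ + ((4 + Real.log R) * d + Real.log H) ≤
      C' * (d : ℝ) ^ B := by
    have hLH : Real.log H ≤ (d : ℝ) ^ B₀ :=
      ((Real.log_lt_iff_lt_exp hH0).2 hHlt).le.trans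
        (Real.rpow_le_rpow_of_exponent_le hd1r (le_max_left _ _))
    have hdB₀ : (d : ℝ) ≤ (d : ℝ) ^ B₀ := by
      calc (d : ℝ) = (d : ℝ) ^ (1 : ℝ) := (Real.rpow_one _).symm
        _ ≤ (d : ℝ) ^ B₀ := Real.rpow_le_rpow_of_exponent_le hd1r hB₀1
    have hdB₀0 : 0 ≤ (d : ℝ) ^ B₀ := Real.rpow_nonneg hd0.le _
    have hbase1 : 1 ≤ (d : ℝ) + Real.log Bh := by linarith [Real.log_nonneg hBh1]
    have hbase : (d : ℝ) + Real.log Bh ≤ 4 * (d : ℝ) ^ B₀ := by linarith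
    have hpow1 : ((d : ℝ) + Real.log Bh) ^ τ ≤ ((d : ℝ) + Real.log Bh) ^ τp :=
      Real.rpow_le_rpow_of_exponent_le hbase1 (le_max_left _ _)
    have hpow2 : ((d : ℝ) + Real.log Bh) ^ τp ≤ (4 * (d : ℝ) ^ B₀) ^ τp :=
      Real.rpow_le_rpow (by linarith) hbase hτp0
    have hpow3 : (4 * (d : ℝ) ^ B₀) ^ τp = (4 : ℝ) ^ τp * (d : ℝ) ^ (B₀ * τp) := by
      rw [Real.mul_rpow (by norm_num) hdB₀0, ← Real.rpow_mul hd0.le]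
    have hexp1 : (d : ℝ) ^ (B₀ * τp) ≤ (d : ℝ) ^ B :=
      Real.rpow_le_rpow_of_exponent_le hd1r (by rw [hB]; linarith)
    have hexp2 : (d : ℝ) ^ B₀ ≤ (d : ℝ) ^ B :=
      Real.rpow_le_rpow_of_exponent_le hd1r (by rw [hB]; nlinarith)
    have t0 : ((d : ℝ) + Real.log Bh) ^ τ ≤ (4 : ℝ) ^ τp * (d : ℝ) ^ B :=
      (hpow1.trans (hpow2.trans hpow3.le)).trans (mul_le_mul_of_nonneg_left hexp1 h4p)
    have t1 : C * ((d : ℝ) + Real.log Bh) ^ τ ≤ C * (4 : ℝ) ^ τp * (d : ℝ) ^ B := by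
      rw [mul_assoc]; exact mul_le_mul_of_nonneg_left t0 hC.le
    have t2 : (4 + Real.log R) * d + Real.log H ≤ (5 + Real.log R) * (d : ℝ) ^ B := by
      have : (4 + Real.log R) * d ≤ (4 + Real.log R) * (d : ℝ) ^ B :=
        mul_le_mul_of_nonneg_left (hdB₀.trans hexp2) (by linarith)
      linarith [hLH.trans hexp2]
    have hsplit : C' * (d : ℝ) ^ B = C * (4 : ℝ) ^ τp * (d : ℝ) ^ B + (5 + Real.log R) * (d : ℝ) ^ B := by
      rw [hC']; ring
    rw [hsplit]; linarith
  -- chain the three bounds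
  have hchain : Real.exp (-(C * ((d : ℝ) + Real.log Bh) ^ τ)) ≤
      Real.exp ((4 + Real.log R) * d + Real.log H) * ‖γ (Sum.inr 0) - θ (Sum.inr 0)‖ := by
    rw [norm_sub_rev]
    exact hlow.trans (hmv.trans (mul_le_mul_of_nonneg_right hD (norm_nonneg _)))
  have hmul : Real.exp ((4 + Real.log R) * d + Real.log H) * Real.exp (-(C' * (d : ℝ) ^ B)) ≤
      Real.exp ((4 + Real.log R) * d + Real.log H) * ‖γ (Sum.inr 0) - θ (Sum.inr 0)‖ := by
    rw [← Real.exp_add]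
    exact le_trans (Real.exp_le_exp.2 (by linarith)) hchain
  exact (le_of_mul_le_mul_left hmul (Real.exp_pos _)).trans hcoord

/-! ### The three height regimes reassemble the typed pointwise crux -/

/-- **ABOVE ∧ WINDOW ∧ FLOOR ⇒ the typed pointwise crux** at an `n = 2` point: the penalty form
(`a < 1`, threshold `T_κ(d) = exp(exp(κ d log(d+2)))`), the typed bound in the window
`exp(d^{b₀}) ≤ H < T_κ(d)` (`a_W < 1`) and a pure-power floor `exp(−C_F d^{b_F})` below
`exp(d^{b₀})` give `ApproxTypeAt 2 s a' b' C'` with `a' = max(a⁺, a_W) < 1`,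
`b' = max(b_W, b_F)`, `C' = max(C + 1, C_W, C_F)`, by monotonicity of `C(dᵃ log H + dᵇ)`. -/
theorem approxTypeAt_of_pen_window_floor {s : Fin 2 → ℂ} {a κ C : ℝ} (ha : a < 1)
    (hpen : ApproxTypePenAt 2 s a κ C) {b₀ aW bW CW : ℝ} (haW : aW < 1) (hCW : 0 < CW)
    (hW : ∀ (d H : ℕ) (γ : Fin 2 ⊕ Fin 2 → ℂ), Real.exp ((d : ℝ) ^ b₀) ≤ (H : ℝ) →
      (H : ℝ) < Real.exp (Real.exp (κ * d * Real.log ((d : ℝ) + 2))) →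
      Module.finrank ℚ ↥(IntermediateField.adjoin ℚ (Set.range γ)) ≤ d →
      (∀ i, ∃ P : Polynomial ℤ, P ≠ 0 ∧ P.natDegree ≤ d ∧ (∀ k, |P.coeff k| ≤ (H : ℤ)) ∧
        Polynomial.aeval (γ i) P = 0) →
      Real.exp (-(CW * ((d : ℝ) ^ aW * Real.log H + (d : ℝ) ^ bW))) ≤
        ‖γ - Sum.elim s (Complex.exp ∘ s)‖)
    {bF CF : ℝ} (hCF : 0 < CF)
    (hF : ∀ (d H : ℕ) (γ : Fin 2 ⊕ Fin 2 → ℂ), (H : ℝ) < Real.exp ((d : ℝ) ^ b₀) →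
      Module.finrank ℚ ↥(IntermediateField.adjoin ℚ (Set.range γ)) ≤ d →
      (∀ i, ∃ P : Polynomial ℤ, P ≠ 0 ∧ P.natDegree ≤ d ∧ (∀ k, |P.coeff k| ≤ (H : ℤ)) ∧
        Polynomial.aeval (γ i) P = 0) →
      Real.exp (-(CF * (d : ℝ) ^ bF)) ≤ ‖γ - Sum.elim s (Complex.exp ∘ s)‖) :
    ∃ a' b' C' : ℝ, a' < 1 ∧ ApproxTypeAt 2 s a' b' C' := by
  have hC : 0 < C := hpen.1
  set a' : ℝ := max (max a 0) aW with ha'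
  set b' : ℝ := max bW bF with hb'
  set C' : ℝ := max (C + 1) (max CW CF) with hC'
  have ha'1 : a' < 1 := max_lt (max_lt ha one_pos) haW
  have hC'pos : 0 < C' := lt_of_lt_of_le (by linarith) (le_max_left _ _)
  refine ⟨a', b', C', ha'1, hC'pos, ?_⟩
  intro d H γ hfr hpoly
  obtain ⟨hd1, hH1⟩ := one_le_of_clause (hpoly (Sum.inl 0))
  have hd0 : (0 : ℝ) < d := one_pos.trans_le hd1
  have hlogH : 0 ≤ Real.log H := Real.log_nonneg hH1
  by_cases hA : Real.exp (Real.exp (κ * d * Real.log ((d : ℝ) + 2))) ≤ (H : ℝ)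
  · -- ABOVE the Ably threshold: the penalty form
    refine le_trans (Real.exp_le_exp.2 (neg_le_neg ?_)) (typed_above_of_pen hpen b' d H γ hA hfr hpoly)
    exact typedExponent_mono hd1 hlogH (by linarith) (le_max_left _ _) (le_max_left _ _) le_rfl
  push Not at hA
  by_cases hWin : Real.exp ((d : ℝ) ^ b₀) ≤ (H : ℝ)
  · -- the WINDOW
    refine le_trans (Real.exp_le_exp.2 (neg_le_neg ?_)) (hW d H γ hWin hA hfr hpoly)
    exact typedExponent_mono hd1 hlogH hCW.le ((le_max_left _ _).trans (le_max_right _ _))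
      (le_max_right _ _) (le_max_left _ _)
  · -- BELOW `exp(d^{b₀})`: the pure-power floor
    push Not at hWin
    refine le_trans (Real.exp_le_exp.2 (neg_le_neg ?_)) (hF d H γ hWin hfr hpoly)
    have h2 : (d : ℝ) ^ bF ≤ (d : ℝ) ^ b' := Real.rpow_le_rpow_of_exponent_le hd1 (le_max_right _ _)
    have h3 : CF ≤ C' := (le_max_right _ _).trans (le_max_right _ _)
    have hda' : 0 ≤ (d : ℝ) ^ a' * Real.log H := mul_nonneg (Real.rpow_nonneg hd0.le _) hlogH
    have hdb' : 0 ≤ (d : ℝ) ^ b' := Real.rpow_nonneg hd0.le _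
    have hdbF : 0 ≤ (d : ℝ) ^ bF := Real.rpow_nonneg hd0.le _
    nlinarith [h2, h3, hda', hdb', hCF, hdbF]

/-! ### The Lindemann–Weierstrass layer and the composition of the line -/

/-- **The LW layer of the typed crux from the five LW stubs**: at `s ∈ ℚ̄²` with `ℚ`-linearly
independent coordinates, ABOVE (stubs 1–3, penalty form at threshold `κ`) + the WINDOW at that `κ`
(stub 5, choosing `b₀`) + the FLOOR below `exp(d^{b₀})` (stub 4 at the slot `e^{s₀}`, `s₀ ≠ 0` by
linear independence) give `∃ a < 1, ApproxTypeAt 2 s a b C`. -/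
theorem approxTypeAt_two_of_LW_windows (h₁ : LWPenaltyMeasure) (hT : CodimOneTransferX)
    (hD : SlotDichotomyXTwo) (hE : ExpFiniteType) (hW : LWWindowTwo) (s : Fin 2 → ℂ)
    (halg : ∀ i, IsAlgebraic ℚ (s i)) (hli : LinearIndependent ℚ s) :
    ∃ a b C : ℝ, a < 1 ∧ ApproxTypeAt 2 s a b C := by
  obtain ⟨a, κ, C, ha, hpen⟩ := approxTypePenAt_two_of_LW h₁ hT hD s halg hli
  obtain ⟨b₀, aW, bW, CW, haW, hCW, hwin⟩ := hW s halg hli κ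
  obtain ⟨τ, C₁, hft⟩ := hE (s 0) (halg 0) (hli.ne_zero 0)
  obtain ⟨bF, CF, hCF, hfloor⟩ := approxFloor_of_finiteType s hft b₀
  exact approxTypeAt_of_pen_window_floor ha hpen haW hCW hwin hCF hfloor

/-- **The seven stub statements imply the crux, pointwise form** (the crux itself is this statement by
`khovanskiiApproxType_iff`, `Iff.rfl`): `n ≥ 3` is the residual stub; at `n = 2` the LW layer is
`approxTypeAt_two_of_LW_windows`, and off the LW layer the inputs stub feeds the landed
`approxTypeAt_two_of_inputs` (transfer + slot dichotomy with polynomial penalty, unconditional). -/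
theorem khovanskiiApproxType_of_stubs :
    LWPenaltyMeasure → CodimOneTransferX → SlotDichotomyXTwo → ExpFiniteType → LWWindowTwo →
      NonLWInputsTwo → RankThreeUp →
      ∀ (n : ℕ) (s : Fin n → ℂ), 2 ≤ n → LinearIndependent ℚ s → IsFreeKhovanskii n s →
        ∃ a b C : ℝ, a < 1 / ((n : ℝ) - 1) ∧ ApproxTypeAt n s a b C := by
  intro h₁ hT hD hE hW hN hR n s hn hli hfree
  by_cases h3 : 3 ≤ n
  · exact hR n s h3 hli hfree
  obtain rfl : n = 2 := by omega
  have key : ∃ a b C : ℝ, a < 1 ∧ ApproxTypeAt 2 s a b C := by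
    by_cases halg : ∀ i, IsAlgebraic ℚ (s i)
    · exact approxTypeAt_two_of_LW_windows h₁ hT hD hE hW s halg hli
    · push Not at halg
      obtain ⟨i, hi⟩ := halg
      obtain ⟨e, he, μ, K, C, A, hμ, hK, hA, hrace, hC, hfl⟩ := hN s hli hfree ⟨i, hi⟩
      exact approxTypeAt_two_of_inputs s e he μ K C A hμ hK hA hrace hC hfl
  obtain ⟨a, b, C, ha, hat⟩ := key
  refine ⟨a, b, C, ?_, hat⟩
  have h1 : (1 : ℝ) / (((2 : ℕ) : ℝ) - 1) = 1 := by norm_num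
  rw [h1]
  exact ha

/-- **The skeleton concludes the crux BY NAME.** `KhovanskiiApproxType` (route `DiophantineDichotomy`,
stmt-Schanuel-6116) from the seven registered stubs. -/
theorem KhovanskiiApproxType_of : KhovanskiiApproxType :=
  khovanskiiApproxType_iff.2
    (khovanskiiApproxType_of_stubs stub_lwPenaltyMeasure stub_penaltyTransfer
      stub_penaltySlotDichotomy_two stub_expFiniteType stub_lwWindow_two stub_nonLWInputs_two
      stub_rankThreeUp)

/-! ### Relation to the picked line `lw-small-height` -/

/-- The picked line's two research stubs close this line's open stub: all-height small-height
Lindemann–Weierstrass measures `LWSmallHeight 1 ∧ 2` give the typed bound at ALL heights (landed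
`approxTypeAt_two_of_LW`), in particular in every window. -/
theorem lwWindowTwo_of_lwSmallHeight (h₁ : LWSmallHeight 1) (h₂ : LWSmallHeight 2) : LWWindowTwo := by
  intro s halg hli κ
  obtain ⟨a, b, C, ha, hC, hall⟩ := approxTypeAt_two_of_LW h₁ h₂ s halg hli
  exact ⟨0, a, b, C, ha, hC, fun d H γ _ _ hfr hpoly => hall d H γ hfr hpoly⟩

end Summit.Schanuel.Schanuel.Cruxes.KhovanskiiApproxType.HeightWindowCompactness

end
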